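import Mathlib
import Summits.Ventures.PercRepro2.Defs
import Summits.Ventures.PercRepro2.Graph
import Summits.Ventures.PercRepro2.DisagreementPinned
import Summits.Ventures.PercRepro2.TypedA3Inactive
import Summits.Ventures.PercRepro2.TypedSpectator
import Summits.Ventures.PercRepro2.TypedSwitchingPrimed
import Summits.Ventures.PercRepro2.TypedSignSpectator
import Summits.Ventures.PercRepro2.OneColourSwitch
import Summits.Ventures.PercRepro2.OneColourSwitchFibre
import Summits.Ventures.PercRepro2.M9PendantFibreSign
import Summits.Ventures.PercRepro2.TypedM9Pendant
import Summits.Ventures.PercRepro2.CutVertexPaths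
import Summits.Ventures.PercRepro2.CutVertexM9
import Summits.Ventures.PercRepro2.CutVertexHarrisFibre
import Summits.Ventures.PercRepro2.CutVertexM9Fibre

/-!
# `m9` in the typed calculus at a cut vertex (blind cell PercRepro2, p3 g16, 2026-08-27;
`proofs/P3-CPNC.md` §13)

The cut-vertex class theorem of the switching move `m9` in the crux's own vocabulary: for the real
connectivity state map `connState ends p q r s` (typer-1 g44's `TypedSignSpectator`), every typed
triple count `typedCount F z τ (kerSign (connState …) g)` with `g ≥ 0` and types in `{1, 2}` on
`F` is `≤ 0` as soon as one vertex `v` separates `{p,q}` from `{r,s}` in the support multigraph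
(`CutVertexM9.CutVertex` — a property of ALL edges, free or pinned), hence `m9` holds on
`(F, z, τ)` (`typedCount_m9_iff_sign`).  Proof: the bridge `typedCount_kerSign_nonpos_of_fibres`
reduces it to the spectator fibres, and on EVERY fibre the sum is `m9SignSumF`, which is `≤ 0` by
the fibre product formula `CutVertexM9.m9SignSumF_nonpos_of_cutVertex` — no case on absent or
double edges is needed, the cut vertex survives every pinning.  Together with
`typedCount_m9_connState_of_pendant` the second class theorem of `m9` in the typed calculus.
Own work on the cell's chain; standard axioms.
-/

namespace Summit.Ventures.PercRepro2

namespace OneColourSwitch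

open Finset Classical CovForm.PairHarris CovForm.TypedA3

variable {V : Type*} {E : Type*}
variable (ends : E → Sym2 V)

section Bridge

variable [Fintype E] [DecidableEq E]
variable {R : Type*} [Field R] [LinearOrder R] [IsStrictOrderedRing R]

/-- **`m9` in the typed calculus at a cut vertex** (the real state map `connState`; types in
`{1, 2}` on `F`; `g ≥ 0`): the typed sign count is `≤ 0`. -/
theorem typedCount_kerSign_connState_nonpos_of_cutVertex (F : Finset E) (z : Config E)
    (τ : E → ℕ) (hτ : ∀ e ∈ F, τ e = 1 ∨ τ e = 2) (g : St6 → R) (hg : ∀ t, 0 ≤ g t)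
    {side : E → Bool} {L : Set V} {v : V} {Rt : Set V}
    (h : CutVertexM9.CutVertex ends side L v Rt) {p q r s : V}
    (hp : p ∈ L ∨ p = v) (hq : q ∈ L ∨ q = v) (hr : r ∈ Rt ∨ r = v) (hs : s ∈ Rt ∨ s = v) :
    typedCount F z τ (kerSign (connState ends p q r s) g) ≤ 0 := by
  apply typedCount_kerSign_nonpos_of_fibres F z τ hτ _ g hg
  intro x _
  rw [pinnedCount_signKer_connState, bridge_fibre_sum_eq_cast]
  exact_mod_cast CutVertexM9.m9SignSumF_nonpos_of_cutVertex h hp hq hr hs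
    (↑(specFree F τ x) : Set E) (specPin F z τ x)

/-- **The move `m9` itself on `(F, z, τ)` at a cut vertex**:
`c(pq|rs, SEP) ≤ c(pq|r|s, rs|p|q)` for the real state map. -/
theorem typedCount_m9_connState_of_cutVertex (F : Finset E) (z : Config E) (τ : E → ℕ)
    (hτ : ∀ e ∈ F, τ e = 1 ∨ τ e = 2) (g : St6 → R) (hg : ∀ t, 0 ≤ g t)
    {side : E → Bool} {L : Set V} {v : V} {Rt : Set V}
    (h : CutVertexM9.CutVertex ends side L v Rt) {p q r s : V}
    (hp : p ∈ L ∨ p = v) (hq : q ∈ L ∨ q = v) (hr : r ∈ Rt ∨ r = v) (hs : s ∈ Rt ∨ s = v) :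
    typedCount F z τ (kerM9Src (connState ends p q r s) g) ≤
      typedCount F z τ (kerM9Tgt (connState ends p q r s) g) :=
  (typedCount_m9_iff_sign F z τ _ g).2
    (typedCount_kerSign_connState_nonpos_of_cutVertex ends F z τ hτ g hg h hp hq hr hs)

end Bridge

end OneColourSwitch

end Summit.Ventures.PercRepro2
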